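import Literature.Computability.QuantumComplexity.OversamplingClosure
import Literature.Analysis.Matrix.HoffmanWielandt
import HarnessLib

/-!
# Sketching preserves singular values (CGLLTW 2022, §3.2 Lemma "Approximating singular values")

Chia, Gilyén, Li, Lin, Tang, Wang, J. ACM 69(5):33 (2022) = arXiv:1910.06151, **§3.2** and its
proof in **§5.2** (numbering and wording of the held arXiv text):

> The above results can be used to approximate singular values, simply by directly translating the
> bounds on matrix product error to bounds on singular value error.
>
> **Lemma (Approximating singular values).** Given `SQ_φ(A) ∈ ℂ^{m×n}` and `ε ∈ (0,1]`, we can form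
> importance sampling sketches `S ∈ ℝ^{r×m}` and `T† ∈ ℝ^{c×n}` in `O((r+c) s_φ(A))` time
> satisfying the following property. Take `r = Ω̃(φ²/ε² · log(1/δ))` and `c = Ω̃(φ²/ε² · log(1/δ))`.
> Then, if `σ_i` and `σ̂_i` are the singular values of `A` and `SAT`, respectively (where `σ̂_i = 0`
> for `i > min(r,c)`), with probability `≥ 1−δ`, `√(Σ_{i=1}^{min(m,n)} (σ̂_i² − σ_i²)²) ≤ ε‖A‖_F²`.
>
> *Proof.* We use known theorems, plugging in the values of `r` and `c`. Using Lemma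
> "Approximating matrix multiplication" for the sketch `S`, we know that
> `Pr[‖A†S†SA − A†A‖_F ≤ ε‖A‖_F²] ≥ 1−δ`; […] Then, from Lemma 5.2 (Hoffman–Wielandt),
> `√(Σ (σ_i(SA)² − σ_i(A)²)²) ≤ ε‖A‖_F²`, `√(Σ (σ_i(SAT)² − σ_i(SA)²)²) ≤ ε‖A‖_F²`. The result
> follows from the triangle inequality. □

This file proves the first of the two displayed inequalities — **the row sketch `S` preserves the
singular values of `A`** — as an exact finite-probability statement, by composing the tree's key
lemma (`SubsampledMatrixProduct.approx_matrix_product'`, the `log(1/δ)` form, with `X = Y = A` and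
`p = q = 𝒟_ã` from `SQ_φ(A)` — `OversamplingClosure`'s `isOversampledDist_rowDist`) with the
Hoffman–Wielandt inequality (`Literature.Analysis.Matrix.HoffmanWielandt.hoffman_wielandt_real`)
applied to the real symmetric matrices `(SA)ᵀ(SA)` and `AᵀA`, whose (decreasingly sorted)
eigenvalues are `σ_i(SA)²` and `σ_i(A)²`:

* `sketch_preserves_singular_values`: for `SQ_φ(A)`, `A ≠ 0`, `s ≥ 1` rows and every `δ > 0`, the
  `𝒟_ã`-mass of the sample sequences `ω` with
  `√(Σ_k (λ_k↓((S_ωA)ᵀ(S_ωA)) − λ_k↓(AᵀA))²) < √(8φ² log(2/δ)/s) · ‖A‖_F²` exceeds `1 − δ`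
  (i.e. `ε = √(8φ² log(2/δ)/s)`, equivalently `s = 8φ² log(2/δ)/ε²` — the printed
  `r = Ω̃(φ² log(1/δ)/ε²)`).

Not formalized here: the column sketch `T` (the same statement applied to `(SA)ᵀ`, with `‖SA‖_F² ≤
2‖A‖_F²` w.h.p. from Lemma 5.1) and the final combination across the differently-sized spectra of
`SAT` (`r×c`) and `A` (`m×n`) by zero-padding ("`σ̂_i = 0` for `i > min(r,c)`"); the spectral-norm
variant (Weyl + Rudelson–Vershynin).  Real entries as in the rest of the toolbox.  No named facts
are introduced; everything stated is proved.

## References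
* [ChiaEtAl2022] N.-H. Chia, A. Gilyén, T. Li, H.-H. Lin, E. Tang, C. Wang, J. ACM 69(5):33, 2022
  (= arXiv:1910.06151), §3.2 Lemma "Approximating singular values" (held text p. 19 L25–36) and
  §5.2 its proof (p. 37 L1–23), Lemma 5.2 (Hoffman–Wielandt).
* [HornJohnson2013] R. A. Horn, C. R. Johnson, *Matrix Analysis*, 2nd ed., Cor. 6.3.8 — via
  `Literature.Analysis.Matrix.HoffmanWielandt`.
-/

noncomputable section

open scoped Matrix

namespace Literature.Computability.QuantumComplexity

namespace SampleQuery

open Finset Literature.Analysis.Matrix.HoffmanWielandt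

variable {m n s : ℕ} {φ : ℝ} {A : Matrix (Fin m) (Fin n) ℝ}

/-- `AᵀA` is symmetric (real Hermitian); its eigenvalues are the squared singular values of `A`.
[cite: ChiaEtAl2022, §5.2, proof of Lemma "Approximating singular values" (`σ_i(A)²`)] -/
theorem isHermitian_transpose_mul_self (A : Matrix (Fin m) (Fin n) ℝ) : (Aᵀ * A).IsHermitian := by
  simpa [Matrix.conjTranspose_eq_transpose_of_trivial] using Matrix.isHermitian_conjTranspose_mul_self A

/-- **Hoffman–Wielandt step**: `Σ_k (σ_k(SA)² − σ_k(A)²)² ≤ ‖(SA)ᵀ(SA) − AᵀA‖_F²`, the squared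
singular values being the decreasingly sorted eigenvalues of the Gram matrices.
[cite: ChiaEtAl2022, §5.2, proof of Lemma "Approximating singular values" ("from Lemma 5.2,
`√Σ(σ_i(SA)² − σ_i(A)²)² ≤ ε‖A‖_F²`")] -/
theorem sum_sq_singularValueSq_sub_le (B : Matrix (Fin s) (Fin n) ℝ) (A : Matrix (Fin m) (Fin n) ℝ) :
    ∑ k, ((isHermitian_transpose_mul_self B).eigenvalues₀ k -
        (isHermitian_transpose_mul_self A).eigenvalues₀ k) ^ 2 ≤ frobSq (Bᵀ * B - Aᵀ * A) := by
  rw [frobSq_sub]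
  have h := hoffman_wielandt_real (isHermitian_transpose_mul_self B) (isHermitian_transpose_mul_self A)
  simpa only [Matrix.sub_apply] using h

/-- **Sketching preserves singular values** (row sketch): given `SQ_φ(A)` (`A ≠ 0`), let `S` have
`s ≥ 1` rows sampled according to `𝒟_ã` (the row-norm distribution of `Ã`). For every `δ > 0`, with
`𝒟_ã`-probability `> 1 − δ` over the sample sequence,
`√(Σ_k (σ_k(SA)² − σ_k(A)²)²) < √(8φ² log(2/δ)/s) ‖A‖_F²`.
[cite: ChiaEtAl2022, §3.2 Lemma "Approximating singular values" (first display of its §5.2 proof,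
with Lemma "Approximating matrix multiplication" and Lemma 5.2)] -/
theorem sketch_preserves_singular_values (W : MatrixOversamplingWitness φ A) (hA : A ≠ 0)
    (hs : 0 < s) {δ : ℝ} (hδ : 0 < δ) :
    1 - δ < ∑ ω ∈ univ.filter (fun ω : Fin s → Fin m =>
        Real.sqrt (∑ k,
          ((isHermitian_transpose_mul_self (sketch (rowDist W.tilde) ω * A)).eigenvalues₀ k -
            (isHermitian_transpose_mul_self A).eigenvalues₀ k) ^ 2) <
          Real.sqrt (8 * φ ^ 2 * Real.log (2 / δ) / s) * frobSq A),
      iidWeight (rowDist W.tilde) ω := by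
  classical
  have hp := W.isOversampledDist_rowDist hA
  have hφ := W.pos hA
  -- the key lemma with `X = Y = A`, `p = q = 𝒟_ã` (so `r = (p+q)/2 = 𝒟_ã`)
  have hkey := approx_matrix_product' hp hp hφ hφ hA hA hs hδ
  have havg : (fun k => (rowDist W.tilde k + rowDist W.tilde k) / 2) = rowDist W.tilde :=
    funext fun k => by ring
  rw [havg] at hkey
  have hthr : Real.sqrt (8 * φ * φ * Real.log (2 / δ) / s) *
      (Real.sqrt (frobSq A) * Real.sqrt (frobSq A)) =
      Real.sqrt (8 * φ ^ 2 * Real.log (2 / δ) / s) * frobSq A := by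
    rw [Real.mul_self_sqrt (frobSq_nonneg A), sq, ← mul_assoc]
  rw [hthr] at hkey
  -- the Frobenius event implies the singular-value event (Hoffman–Wielandt)
  refine lt_of_lt_of_le hkey (sum_le_sum_of_subset_of_nonneg ?_ fun ω _ _ =>
    iidWeight_nonneg hp.nonneg ω)
  intro ω hω
  simp only [mem_filter, mem_univ, true_and] at hω ⊢
  refine lt_of_le_of_lt (Real.sqrt_le_sqrt ?_) hω
  exact sum_sq_singularValueSq_sub_le _ _

end SampleQuery

end Literature.Computability.QuantumComplexity

end
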